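import Literature.Probability.RandomPlanarGeometry.RadialBesselSLE
import Literature.Probability.RandomPlanarGeometry.SLELawOfDrivingProcess
import Literature.Probability.RandomPlanarGeometry.StationaryAngleTimeScale
import Literature.Probability.Process.MartingaleProblemTilting
import HarnessLib

/-!
# The radial Bessel flow of a marked point solves the SLE_κ(0) angle martingale problem — for every Brownian motion

Topic `Probability/RandomPlanarGeometry`; definitions with bodies and proved theorems (no named
fact). The level-`n` radial Bessel flow `Y` of a boundary point at angle `θ` from the driving point
of the radial Loewner chain driven by `√κ B` (`RadialLoewner.argLevel`; Lawler (2005), (6.12):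
`Ẏ = cot(Y/2) - √κ Ḃ` up to its exit `σₙ` from `(2δₙ, 2π - 2δₙ)`; LSW (2002), (2.9)–(2.11))
stopped at `σₙ`, `V = Y^{σₙ}`, solves the **`(κ, 0)` angle martingale problem in martingale
form**: for every `C²` test function `F` supported in `(2δₙ, 2π - 2δₙ)`,

  `F(V_t) - F(V_0) - ∫₀ᵗ (L₀ F)(V_s) ds`,   `L₀ = angleGenerator κ 0 = (κ/2)∂² + cot(·/2)∂`,

is a martingale. On the canonical Wiener space this is the tree's Itô computation
`RadialLoewner.martingale_expGenerator_sleArgLevel` (μ = 0); since the generator of a test function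
supported in the open band vanishes at the frozen endpoint value, the truncated drift is the plain
time integral (`RadialLoewner.martingale_angleMP_sleArgLevel`). We then **transfer the statement to
an arbitrary real Brownian motion `B` with continuous paths on an arbitrary probability space**
(`RadialLoewner.martingale_angleMP_argLevel`), with respect to the natural filtration of `√κ B`:
the flow is a functional of the driving path (uniqueness for the integrated equation,
`eqOn_argTrunc_of_integral_eq`), the law of the path `√κ B` is that of the canonical driving
function (`map_eq_map_sleDriving_of_isPreBrownianReal`), every event of the natural filtration is
the preimage of a path event of the past, and the martingale property is an identity between set
integrals of measurable path functionals. This is the form in which the exponential change of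
measure `exists_tilted_measure_target` (any filtered probability space) consumes the radial Bessel
flow in the proof that radial SLE_κ is generated by a curve.

## References

* G. F. Lawler, *Conformally Invariant Processes in the Plane*, AMS (2005), §6.4 eq. (6.12),
  §1.11. [Lawler2005]
* G. F. Lawler, O. Schramm, W. Werner, *One-arm exponent for critical 2D percolation*, Electron. J.
  Probab. 7 (2002), §2 (2.9)–(2.11). [LawlerSchrammWernerEJP2002]
* I. Karatzas, S. Shreve, *Brownian Motion and Stochastic Calculus* (1988), Ch. 5 §4.B
  (martingale problem; laws of solutions). [KaratzasShreve1988]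
-/

noncomputable section

open MeasureTheory ProbabilityTheory Filter Set Function
open scoped NNReal ENNReal Topology

namespace Literature.Probability.RandomPlanarGeometry

namespace RadialLoewner

open Literature.Probability.Process Literature.Analysis.FunctionSpaces

/-! ### The generator at `μ = 0` is the `(κ, 0)` angle generator -/

/-- `Λ₀ F = L₀ F`: the LSW operator without potential is `angleGenerator κ 0`. [folklore] -/
theorem expGenerator_zero (κ : ℝ≥0) (F : ℝ → ℝ) : expGenerator κ 0 F = angleGenerator κ 0 F := by
  funext y
  rw [expGenerator_apply, angleGenerator]
  ring

/-! ### Canonical space: the martingale problem in martingale form -/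

section Canonical

variable {κ : ℝ≥0} {n : ℕ} {θ : ℝ}

/-- **The stopped level-`n` SLE_κ radial Bessel flow solves the `(κ, 0)` angle martingale problem**
(canonical Wiener space, raw Brownian filtration): for `F ∈ C²` supported in the open band
`(2δₙ, 2π - 2δₙ)` and a start `θ` inside it,
`F(V_t) - F(V_0) - ∫₀ᵗ L₀F(V_s) ds` is a martingale, `V = Y^{σₙ}`
(`martingale_expGenerator_sleArgLevel` with `μ = 0`; after `σₙ` the frozen value is an endpoint of
the band, where `L₀F = 0`). [cite: LawlerSchrammWernerEJP2002, §2 proof of Lemma 2.2] -/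
theorem martingale_angleMP_sleArgLevel (hθ : θ ∈ Ioo (2 * level n) (2 * Real.pi - 2 * level n))
    {F : ℝ → ℝ} (hF : ContDiff ℝ 2 F)
    (hsupp : tsupport F ⊆ Ioo (2 * level n) (2 * Real.pi - 2 * level n)) :
    Martingale (fun t ω ↦ F (stoppedProcess (sleArgLevel κ n θ) (sleExitLevel κ n θ) t ω) -
        F (stoppedProcess (sleArgLevel κ n θ) (sleExitLevel κ n θ) 0 ω) -
        timeIntegral (fun s ω ↦ angleGenerator κ 0 F
          (stoppedProcess (sleArgLevel κ n θ) (sleExitLevel κ n θ) s ω)) t ω)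
      brownianFiltration preWienerMeasure := by
  haveI := isProbabilityMeasure_preWienerMeasure'
  have hM := martingale_expGenerator_sleArgLevel (κ := κ) hθ hF 0
  set V := stoppedProcess (sleArgLevel κ n θ) (sleExitLevel κ n θ) with hV
  -- the truncated drift is the plain time integral of `L₀F(V)`
  have hdrift : ∀ (s : ℝ≥0) (ω : ℝ≥0 → ℝ), genDrift κ n θ 0 F s ω = angleGenerator κ 0 F (V s ω) := by
    intro s ω
    rw [genDrift_apply, trunc_apply]
    split_ifs with h
    · rw [zero_mul, Real.exp_zero, one_mul, expGenerator_zero]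
    · -- after the exit time the flow sits at an endpoint of the band, off the support of `F`
      rw [not_le] at h
      obtain ⟨T, hT⟩ := WithTop.ne_top_iff_exists.1 h.ne_top
      have hTs : T ≤ s := by rw [← hT] at h; exact (WithTop.coe_lt_coe.1 h).le
      have hfrozen : V s ω = sleArgLevel κ n θ T ω := by
        rw [hV, stoppedProcess, ← hT, untopA_min_coe_coe, min_eq_right hTs]
      have hend := argTrunc_truncExit_eq_or (continuous_sleDriving' κ) (level_pos n) (level_le n) hθ ω hT.symm
      have hnot : V s ω ∉ tsupport F := by
        intro hmem
        have := hsupp hmem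
        rw [hfrozen] at this
        rcases hend with h1 | h1
        · rw [show sleArgLevel κ n θ T ω = 2 * level n from h1] at this
          exact lt_irrefl _ this.1
        · rw [show sleArgLevel κ n θ T ω = 2 * Real.pi - 2 * level n from h1] at this
          exact lt_irrefl _ this.2
      rw [angleGenerator_eq_zero_of_notMem_tsupport hnot]
  have heq : (fun t ω ↦ F (V t ω) - F (V 0 ω) - timeIntegral (fun s ω ↦ angleGenerator κ 0 F (V s ω)) t ω) =
      fun t ω ↦ (expClock κ n θ 0 t ω * F (V t ω) - ∫ s in (0 : ℝ)..t, genDrift κ n θ 0 F s.toNNReal ω) -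
        F θ := by
    funext t ω
    have h0 : V 0 ω = θ := by
      rw [hV, stoppedProcess, untopA_min_zero]
      exact argTrunc_zero _ _ _ θ ω
    rw [expClock_apply, zero_mul, Real.exp_zero, one_mul, h0, timeIntegral_apply_eq_intervalIntegral]
    simp only [hdrift]
    ring
  rw [heq]
  exact hM.sub (martingale_const _ _ _)

end Canonical

/-! ### A family-independent description of the flow -/

section Functional

variable {Ω Ω' : Type*} {U : Ω → ℝ≥0 → ℝ} {U' : Ω' → ℝ≥0 → ℝ}

/-- **The truncated flow depends on `ω` only through the driving path**: two families and samples
with the same driving path have the same flow (uniqueness of continuous solutions of the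
integrated equation, `eqOn_argTrunc_of_integral_eq`). [folklore] -/
theorem argTrunc_eq_of_path_eq (hc : ∀ ω, Continuous (U ω)) (hc' : ∀ ω, Continuous (U' ω))
    {δ : ℝ} (hδ : 0 < δ) (hδ' : δ ≤ Real.pi / 2) (θ : ℝ) {ω : Ω} {ω' : Ω'} (h : U ω = U' ω')
    (t : ℝ≥0) : argTrunc U δ hc hδ hδ' θ t ω = argTrunc U' δ hc' hδ hδ' θ t ω' := by
  refine eqOn_argTrunc_of_integral_eq (t := t) hc' hδ hδ' θ ω' (continuous_argTrunc hc hδ hδ' θ ω)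
    (fun s _ ↦ ?_) t le_rfl
  rw [← h]
  exact argTrunc_eq_integral hc hδ hδ' θ ω

/-- The exit times of two processes with the same path at two samples agree. [folklore] -/
theorem _root_.Literature.Probability.Process.exitTime_eq_of_path_eq {u : ℝ≥0 → Ω → ℝ} {u' : ℝ≥0 → Ω' → ℝ}
    {ω : Ω} {ω' : Ω'} (h : ∀ t, u t ω = u' t ω') (a b : ℝ) :
    Process.exitTime u a b ω = Process.exitTime u' a b ω' := by
  simp only [Process.exitTime, hittingAfter]
  have hc : (∃ j, (0 : ℝ≥0) ≤ j ∧ u j ω ∈ (Ioo a b)ᶜ) ↔ (∃ j, (0 : ℝ≥0) ≤ j ∧ u' j ω' ∈ (Ioo a b)ᶜ) := by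
    simp only [h]
  have hs : {j | (0 : ℝ≥0) ≤ j ∧ u j ω ∈ (Ioo a b)ᶜ} = {j | (0 : ℝ≥0) ≤ j ∧ u' j ω' ∈ (Ioo a b)ᶜ} := by
    simp only [h]
  by_cases hx : ∃ j, (0 : ℝ≥0) ≤ j ∧ u' j ω' ∈ (Ioo a b)ᶜ
  · rw [if_pos (hc.2 hx), if_pos hx, hs]
  · rw [if_neg (fun h' ↦ hx (hc.1 h')), if_neg hx]

/-- The level-`n` exit times agree for equal driving paths. [folklore] -/
theorem exitLevel_eq_of_path_eq (hc : ∀ ω, Continuous (U ω)) (hc' : ∀ ω, Continuous (U' ω)) (n : ℕ)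
    (θ : ℝ) {ω : Ω} {ω' : Ω'} (h : U ω = U' ω') : exitLevel U hc n θ ω = exitLevel U' hc' n θ ω' :=
  Process.exitTime_eq_of_path_eq (fun t ↦ argTrunc_eq_of_path_eq hc hc' (level_pos n) (level_le n) θ h t) _ _

/-- The stopped level-`n` flows agree for equal driving paths. [folklore] -/
theorem stoppedProcess_argLevel_eq_of_path_eq (hc : ∀ ω, Continuous (U ω)) (hc' : ∀ ω, Continuous (U' ω))
    (n : ℕ) (θ : ℝ) {ω : Ω} {ω' : Ω'} (h : U ω = U' ω') (t : ℝ≥0) :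
    stoppedProcess (argLevel U hc n θ) (exitLevel U hc n θ) t ω =
      stoppedProcess (argLevel U' hc' n θ) (exitLevel U' hc' n θ) t ω' := by
  rw [stoppedProcess, stoppedProcess, exitLevel_eq_of_path_eq hc hc' n θ h]
  exact argTrunc_eq_of_path_eq hc hc' (level_pos n) (level_le n) θ h _

end Functional

/-! ### The flow on the space of continuous paths -/

section PathSpace

/-- The space of continuous one-sided real paths (a measurable subtype of the path space). [folklore] -/
abbrev CPath : Type := {p : ℝ≥0 → ℝ // Continuous p}

/-- The driving family on the space of continuous paths: the path itself. [folklore] -/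
def cpathDriving : CPath → ℝ≥0 → ℝ := Subtype.val

/-- All driving paths of the path family are continuous. [folklore] -/
theorem continuous_cpathDriving : ∀ p : CPath, Continuous (cpathDriving p) := fun p ↦ p.2

/-- The coordinates of the space of continuous paths are measurable. [folklore] -/
theorem measurable_coord (t : ℝ≥0) : Measurable fun p : CPath ↦ p.1 t :=
  (measurable_pi_apply t).comp measurable_subtype_coe

/-- The coordinate filtration on the space of continuous paths. [folklore] -/
def pathFiltration : Filtration ℝ≥0 (inferInstance : MeasurableSpace CPath) :=
  Filtration.natural (fun (t : ℝ≥0) (p : CPath) ↦ p.1 t) fun t ↦ (measurable_coord t).stronglyMeasurable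

/-- The coordinates are adapted to the coordinate filtration. [folklore] -/
theorem measurable_cpathDriving_filtration (s : ℝ≥0) :
    Measurable[pathFiltration s] fun p : CPath ↦ cpathDriving p s :=
  (Filtration.stronglyAdapted_natural (u := fun (t : ℝ≥0) (p : CPath) ↦ p.1 t)
    (fun t ↦ (measurable_coord t).stronglyMeasurable) s).measurable

/-- **The stopped level-`n` flow as a measurable functional of the continuous path.** [folklore] -/
def pathFlow (n : ℕ) (θ : ℝ) (t : ℝ≥0) (p : CPath) : ℝ :=
  stoppedProcess (argLevel cpathDriving continuous_cpathDriving n θ)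
    (exitLevel cpathDriving continuous_cpathDriving n θ) t p

/-- The path flow is measurable at each time. [folklore] -/
theorem measurable_pathFlow (n : ℕ) (θ : ℝ) (t : ℝ≥0) : Measurable (pathFlow n θ t) :=
  measurable_stoppedProcess_argLevel (𝓕 := pathFiltration) continuous_cpathDriving
    measurable_cpathDriving_filtration n θ t

/-- The path flow has continuous paths. [folklore] -/
theorem continuous_pathFlow (n : ℕ) (θ : ℝ) (p : CPath) : Continuous fun t ↦ pathFlow n θ t p :=
  continuous_stoppedProcess_apply
    (continuous_argTrunc continuous_cpathDriving (level_pos n) (level_le n) θ p) _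

/-- The path flow is jointly measurable. [folklore] -/
theorem measurable_uncurry_pathFlow (n : ℕ) (θ : ℝ) : Measurable (uncurry (pathFlow n θ)) :=
  measurable_uncurry_of_continuous_of_measurable (continuous_pathFlow n θ) (measurable_pathFlow n θ)

end PathSpace

/-! ### An arbitrary Brownian motion: definitions and adaptedness -/

section General

variable {Ω : Type*} {mΩ : MeasurableSpace Ω} {P : Measure Ω} {B : ℝ≥0 → Ω → ℝ} {κ : ℝ≥0}

/-- The radial driving path `t ↦ √κ B_t(ω)` of a sample. [cite: Lawler2005, §6.4] -/
def bmDriving (κ : ℝ≥0) (B : ℝ≥0 → Ω → ℝ) (ω : Ω) : ℝ≥0 → ℝ := fun t ↦ Real.sqrt κ * B t ω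

/-- The driving paths are continuous when the Brownian paths are. [folklore] -/
theorem continuous_bmDriving (hBc : ∀ ω, Continuous (B · ω)) (ω : Ω) : Continuous (bmDriving κ B ω) :=
  continuous_const.mul (hBc ω)

/-- **The natural filtration of the driving process `√κ B`.** [folklore] -/
def bmFiltration (κ : ℝ≥0) (B : ℝ≥0 → Ω → ℝ) (hBm : ∀ t, Measurable (B t)) : Filtration ℝ≥0 mΩ :=
  Filtration.natural (fun t ω ↦ Real.sqrt κ * B t ω) fun t ↦ ((hBm t).const_mul _).stronglyMeasurable

/-- The driving path is adapted to its natural filtration. [folklore] -/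
theorem measurable_bmDriving_filtration (hBm : ∀ t, Measurable (B t)) (s : ℝ≥0) :
    Measurable[bmFiltration κ B hBm s] fun ω ↦ bmDriving κ B ω s :=
  (Filtration.stronglyAdapted_natural (u := fun t ω ↦ Real.sqrt κ * B t ω)
    (fun t ↦ ((hBm t).const_mul _).stronglyMeasurable) s).measurable

/-- **The stopped level-`n` radial Bessel flow of the marked point at angle `θ`**, for the radial
Loewner chain driven by `√κ B`: `V = Y^{σₙ}` with `Y = argLevel (√κ B) n θ`
(Lawler (2005), (6.12); LSW (2002), (2.9)–(2.11)). [cite: Lawler2005, §6.4 eq. (6.12)] -/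
def bmFlow (κ : ℝ≥0) (B : ℝ≥0 → Ω → ℝ) (hBc : ∀ ω, Continuous (B · ω)) (n : ℕ) (θ : ℝ) (t : ℝ≥0) (ω : Ω) : ℝ :=
  stoppedProcess (argLevel (bmDriving κ B) (continuous_bmDriving hBc) n θ)
    (exitLevel (bmDriving κ B) (continuous_bmDriving hBc) n θ) t ω

variable {hBc : ∀ ω, Continuous (B · ω)} {hBm : ∀ t, Measurable (B t)} {n : ℕ} {θ : ℝ}

/-- **The flow of a sample is the path flow of its driving path.** [folklore] -/
theorem bmFlow_eq_pathFlow (t : ℝ≥0) (ω : Ω) :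
    bmFlow κ B hBc n θ t ω = pathFlow n θ t ⟨bmDriving κ B ω, continuous_bmDriving hBc ω⟩ :=
  stoppedProcess_argLevel_eq_of_path_eq (continuous_bmDriving hBc) continuous_cpathDriving n θ rfl t

/-- **The canonical flow of a sample is the path flow of its driving path.** [folklore] -/
theorem sleFlow_eq_pathFlow (κ : ℝ≥0) (n : ℕ) (θ : ℝ) (t : ℝ≥0) (ω : ℝ≥0 → ℝ) :
    stoppedProcess (sleArgLevel κ n θ) (sleExitLevel κ n θ) t ω =
      pathFlow n θ t ⟨sleDriving κ ω, continuous_sleDriving' κ ω⟩ :=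
  stoppedProcess_argLevel_eq_of_path_eq (continuous_sleDriving' κ) continuous_cpathDriving n θ rfl t

/-- The flow has continuous paths. [folklore] -/
theorem continuous_bmFlow (ω : Ω) : Continuous fun t ↦ bmFlow κ B hBc n θ t ω :=
  continuous_stoppedProcess_apply
    (continuous_argTrunc (continuous_bmDriving hBc) (level_pos n) (level_le n) θ ω) _

/-- The exit time is a stopping time of the natural filtration. [folklore] -/
theorem isStoppingTime_bmExitLevel (hBm : ∀ t, Measurable (B t)) (hBc : ∀ ω, Continuous (B · ω)) (n : ℕ) (θ : ℝ) :
    IsStoppingTime (bmFiltration κ B hBm)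
      (exitLevel (bmDriving κ B) (continuous_bmDriving hBc) n θ) :=
  isStoppingTime_truncExit (continuous_bmDriving hBc) (level_pos n) (level_le n)
    (measurable_bmDriving_filtration hBm) θ

/-- The flow is strongly adapted to the natural filtration. [folklore] -/
theorem stronglyAdapted_bmFlow (hBm : ∀ t, Measurable (B t)) :
    StronglyAdapted (bmFiltration κ B hBm) (bmFlow κ B hBc n θ) :=
  Process.stronglyAdapted_stoppedProcess_exitTime
    (adapted_argTrunc (continuous_bmDriving hBc) (level_pos n) (level_le n)
      (measurable_bmDriving_filtration hBm) θ)
    (continuous_argTrunc (continuous_bmDriving hBc) (level_pos n) (level_le n) θ)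

/-- The flow is progressively measurable. [folklore] -/
theorem isStronglyProgressive_bmFlow (hBm : ∀ t, Measurable (B t)) :
    IsStronglyProgressive (bmFiltration κ B hBm) (bmFlow κ B hBc n θ) :=
  (stronglyAdapted_bmFlow hBm).isStronglyProgressive_of_continuous continuous_bmFlow

/-- The flow starts at `θ`. [folklore] -/
theorem bmFlow_zero (ω : Ω) : bmFlow κ B hBc n θ 0 ω = θ := by
  rw [bmFlow, stoppedProcess, untopA_min_zero]
  exact argTrunc_zero _ _ _ θ ω

/-- **The flow stays in `[2δₙ, 2π - 2δₙ]`** (start inside the band). [folklore] -/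
theorem bmFlow_mem_Icc (hθ : θ ∈ Ioo (2 * level n) (2 * Real.pi - 2 * level n)) (t : ℝ≥0) (ω : Ω) :
    bmFlow κ B hBc n θ t ω ∈ Icc (2 * level n) (2 * Real.pi - 2 * level n) :=
  Process.stoppedProcess_exitTime_mem_Icc
    (continuous_argTrunc (continuous_bmDriving hBc) (level_pos n) (level_le n) θ ω)
    (by rwa [argTrunc_zero]) t

end General

/-! ### The law transfer -/

section Transfer

variable {Ω : Type*} {mΩ : MeasurableSpace Ω} {P : Measure Ω} {B : ℝ≥0 → Ω → ℝ} {κ : ℝ≥0}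
  {hBc : ∀ ω, Continuous (B · ω)} {hBm : ∀ t, Measurable (B t)} {n : ℕ} {θ : ℝ}

/-- The continuous-path-valued driving map of the Brownian motion. [folklore] -/
def bmPath (κ : ℝ≥0) (B : ℝ≥0 → Ω → ℝ) (hBc : ∀ ω, Continuous (B · ω)) (ω : Ω) : CPath :=
  ⟨bmDriving κ B ω, continuous_bmDriving hBc ω⟩

/-- The continuous-path-valued canonical driving map. [folklore] -/
def slePath (κ : ℝ≥0) (ω : ℝ≥0 → ℝ) : CPath := ⟨sleDriving κ ω, continuous_sleDriving' κ ω⟩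

/-- The driving map is measurable. [folklore] -/
theorem measurable_bmPath (hBm : ∀ t, Measurable (B t)) : Measurable (bmPath κ B hBc) :=
  (measurable_pi_lambda _ fun t ↦ (hBm t).const_mul _).subtype_mk

/-- The canonical driving map is measurable. [folklore] -/
theorem measurable_slePath (κ : ℝ≥0) : Measurable (slePath κ) :=
  (measurable_sleDriving_pi κ).subtype_mk

/-- **The laws of the two driving maps agree** (both are the Wiener law of `√κ B`, read on the
measurable subtype of continuous paths). [cite: KaratzasShreve1988, Ch. 5 §4.B] -/
theorem map_bmPath_eq_map_slePath [IsProbabilityMeasure P] (hB : IsBrownianReal B P)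
    (hBm : ∀ t, Measurable (B t)) (hBc : ∀ ω, Continuous (B · ω)) :
    P.map (bmPath κ B hBc) = preWienerMeasure.map (slePath κ) := by
  have hlaw := map_eq_map_sleDriving_of_isPreBrownianReal hB.toIsPreBrownianReal hBm κ
  refine Measure.ext fun S hS ↦ ?_
  obtain ⟨T, hT, rfl⟩ := MeasurableSpace.measurableSet_comap.1 hS
  rw [Measure.map_apply (measurable_bmPath hBm) hS, Measure.map_apply (measurable_slePath κ) hS]
  have e1 : bmPath κ B hBc ⁻¹' (Subtype.val ⁻¹' T) = (fun ω t ↦ Real.sqrt κ * B t ω) ⁻¹' T := rfl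
  have e2 : slePath κ ⁻¹' (Subtype.val ⁻¹' T) = sleDriving κ ⁻¹' T := rfl
  rw [e1, e2, ← Measure.map_apply (measurable_pi_lambda _ fun t ↦ (hBm t).const_mul _) hT,
    ← Measure.map_apply (measurable_sleDriving_pi κ) hT, hlaw]

/-- The natural filtration is the pull-back of the coordinate filtration along the driving map.
[folklore] -/
theorem bmFiltration_eq_comap (hBm : ∀ t, Measurable (B t)) (s : ℝ≥0) :
    (bmFiltration κ B hBm s : MeasurableSpace Ω) = (pathFiltration s).comap (bmPath κ B hBc) := by
  change (⨆ j ≤ s, MeasurableSpace.comap (fun ω ↦ Real.sqrt κ * B j ω) inferInstance) =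
    MeasurableSpace.comap (bmPath κ B hBc) (⨆ j ≤ s, MeasurableSpace.comap (fun p : CPath ↦ p.1 j) inferInstance)
  simp only [MeasurableSpace.comap_iSup, MeasurableSpace.comap_comp]
  rfl

/-- Events of the pulled-back past are events of the canonical past. [folklore] -/
theorem measurableSet_preimage_slePath {s : ℝ≥0} {A₀ : Set CPath}
    (hA₀ : MeasurableSet[pathFiltration s] A₀) :
    MeasurableSet[brownianFiltration s] (slePath κ ⁻¹' A₀) := by
  have hle : (pathFiltration s).comap (slePath κ) ≤ (brownianFiltration s : MeasurableSpace (ℝ≥0 → ℝ)) := by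
    change MeasurableSpace.comap (slePath κ)
      (⨆ j ≤ s, MeasurableSpace.comap (fun p : CPath ↦ p.1 j) inferInstance) ≤ _
    simp only [MeasurableSpace.comap_iSup, MeasurableSpace.comap_comp]
    refine iSup₂_le fun j hj ↦ ?_
    exact (measurable_sleDriving_of_le κ hj).comap_le
  exact hle _ ⟨A₀, hA₀, rfl⟩

/-- **The martingale problem in martingale form for the radial Bessel flow of an arbitrary Brownian
motion.** Let `B` be a real Brownian motion with continuous paths and measurable marginals on a
probability space, `κ ≥ 0`, `n` a level and `θ` a start inside the band `(2δₙ, 2π - 2δₙ)`. Then for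
every `C²` test function `F` supported in the open band, with `V = bmFlow κ B n θ` the stopped
level-`n` flow and `L₀ = angleGenerator κ 0`,
`F(V_t) - F(V_0) - ∫₀ᵗ L₀F(V_s) ds` is a martingale for the natural filtration of `√κ B`
(transfer in law from the canonical space, `martingale_angleMP_sleArgLevel`).
[cite: KaratzasShreve1988, Ch. 5 §4.B] -/
theorem martingale_angleMP_bmFlow [IsProbabilityMeasure P] (hB : IsBrownianReal B P)
    (hBm : ∀ t, Measurable (B t)) (hBc : ∀ ω, Continuous (B · ω))
    (hθ : θ ∈ Ioo (2 * level n) (2 * Real.pi - 2 * level n))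
    {F : ℝ → ℝ} (hF : ContDiff ℝ 2 F)
    (hsupp : tsupport F ⊆ Ioo (2 * level n) (2 * Real.pi - 2 * level n)) :
    Martingale (fun t ω ↦ F (bmFlow κ B hBc n θ t ω) - F (bmFlow κ B hBc n θ 0 ω) -
        timeIntegral (fun s ω ↦ angleGenerator κ 0 F (bmFlow κ B hBc n θ s ω)) t ω)
      (bmFiltration κ B hBm) P := by
  haveI := isProbabilityMeasure_preWienerMeasure'
  have hsupp' : tsupport F ⊆ Ioo 0 (2 * Real.pi) :=
    hsupp.trans (Ioo_subset_Ioo (by linarith [level_pos n]) (by linarith [level_pos n]))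
  have hcpt : HasCompactSupport F :=
    HasCompactSupport.of_support_subset_isCompact isCompact_Icc
      ((subset_tsupport F).trans (hsupp.trans Ioo_subset_Icc_self))
  have hLc : Continuous (angleGenerator κ 0 F) := continuous_angleGenerator hF hsupp'
  obtain ⟨CL, -, hCL⟩ := exists_bound_angleGenerator (κ := κ) (ρ := (0 : ℝ)) hF hcpt hsupp'
  obtain ⟨CF, -, hCF⟩ := exists_bound_of_hasCompactSupport hF.continuous hcpt
  -- the path functional `G`
  set G : ℝ≥0 → CPath → ℝ := fun t p ↦ F (pathFlow n θ t p) - F (pathFlow n θ 0 p) -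
    timeIntegral (fun s p ↦ angleGenerator κ 0 F (pathFlow n θ s p)) t p with hG
  have hjoint : Measurable (uncurry fun s p ↦ angleGenerator κ 0 F (pathFlow n θ s p)) :=
    hLc.measurable.comp (measurable_uncurry_pathFlow n θ)
  have hGm : ∀ t, Measurable (G t) := fun t ↦
    ((hF.continuous.measurable.comp (measurable_pathFlow n θ t)).sub
      (hF.continuous.measurable.comp (measurable_pathFlow n θ 0))).sub
      ((measurable_uncurry_timeIntegral hjoint).comp (measurable_const.prodMk measurable_id))
  have hGb : ∀ t p, |G t p| ≤ CF + CF + CL * t := fun t p ↦ by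
    simp only [hG]
    have h3 := abs_timeIntegral_le (g := fun s p ↦ angleGenerator κ 0 F (pathFlow n θ s p))
      (fun s p ↦ hCL _) t p
    calc |F (pathFlow n θ t p) - F (pathFlow n θ 0 p) -
          timeIntegral (fun s p ↦ angleGenerator κ 0 F (pathFlow n θ s p)) t p|
        ≤ |F (pathFlow n θ t p) - F (pathFlow n θ 0 p)| +
          |timeIntegral (fun s p ↦ angleGenerator κ 0 F (pathFlow n θ s p)) t p| := abs_sub _ _
      _ ≤ (|F (pathFlow n θ t p)| + |F (pathFlow n θ 0 p)|) + CL * t := add_le_add (abs_sub _ _) h3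
      _ ≤ CF + CF + CL * t := by linarith [hCF (pathFlow n θ t p), hCF (pathFlow n θ 0 p)]
  -- the two processes as pull-backs of `G`
  set M : ℝ≥0 → Ω → ℝ := fun t ω ↦ F (bmFlow κ B hBc n θ t ω) - F (bmFlow κ B hBc n θ 0 ω) -
    timeIntegral (fun s ω ↦ angleGenerator κ 0 F (bmFlow κ B hBc n θ s ω)) t ω with hM
  have hMG : ∀ t ω, M t ω = G t (bmPath κ B hBc ω) := fun t ω ↦ by
    simp only [hM, hG, bmFlow_eq_pathFlow, timeIntegral_apply_eq_intervalIntegral]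
    rfl
  set Mc : ℝ≥0 → (ℝ≥0 → ℝ) → ℝ := fun t ω ↦ F (stoppedProcess (sleArgLevel κ n θ) (sleExitLevel κ n θ) t ω) -
    F (stoppedProcess (sleArgLevel κ n θ) (sleExitLevel κ n θ) 0 ω) -
    timeIntegral (fun s ω ↦ angleGenerator κ 0 F
      (stoppedProcess (sleArgLevel κ n θ) (sleExitLevel κ n θ) s ω)) t ω with hMc
  have hMcG : ∀ t ω, Mc t ω = G t (slePath κ ω) := fun t ω ↦ by
    simp only [hMc, hG, sleFlow_eq_pathFlow, timeIntegral_apply_eq_intervalIntegral]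
    rfl
  have hcan : Martingale Mc brownianFiltration preWienerMeasure := martingale_angleMP_sleArgLevel hθ hF hsupp
  -- adaptedness and integrability on `Ω`
  have hprog := isStronglyProgressive_bmFlow (κ := κ) (hBc := hBc) (n := n) (θ := θ) hBm
  have hMad : ∀ t, StronglyMeasurable[bmFiltration κ B hBm t] (M t) := fun t ↦ by
    refine (((hF.continuous.comp_stronglyMeasurable (hprog.stronglyAdapted t)).sub
      ((hF.continuous.comp_stronglyMeasurable (hprog.stronglyAdapted 0)).mono
        ((bmFiltration κ B hBm).mono bot_le))).sub ?_)
    exact (adapted_timeIntegral (IsStronglyProgressive.continuous_comp hprog hLc) t).stronglyMeasurable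
  have hMint : ∀ t, Integrable (M t) P := fun t ↦
    Integrable.mono' (integrable_const (CF + CF + CL * t))
      ((hMad t).mono ((bmFiltration κ B hBm).le t)).aestronglyMeasurable
      (Eventually.of_forall fun ω ↦ by rw [Real.norm_eq_abs, hMG]; exact hGb t _)
  -- the set-integral identity, transported
  refine ⟨hMad, fun s t hst ↦ ?_⟩
  symm
  refine ae_eq_condExp_of_forall_setIntegral_eq ((bmFiltration κ B hBm).le s) (hMint t)
    (fun A _ _ ↦ (hMint s).integrableOn) (fun A hA _ ↦ ?_) (hMad s).aestronglyMeasurable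
  -- `A` is the preimage of a path event of the past
  rw [bmFiltration_eq_comap (hBc := hBc) hBm s] at hA
  obtain ⟨A₀, hA₀, rfl⟩ := MeasurableSpace.measurableSet_comap.1 hA
  have hA₀m : MeasurableSet A₀ := pathFiltration.le s A₀ hA₀
  have hlaw := map_bmPath_eq_map_slePath (κ := κ) hB hBm hBc
  have key : ∀ r : ℝ≥0, ∫ ω in bmPath κ B hBc ⁻¹' A₀, M r ω ∂P =
      ∫ ω in slePath κ ⁻¹' A₀, Mc r ω ∂preWienerMeasure := by
    intro r
    have h1 : ∫ ω in bmPath κ B hBc ⁻¹' A₀, M r ω ∂P = ∫ p in A₀, G r p ∂(P.map (bmPath κ B hBc)) := by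
      rw [setIntegral_map hA₀m ((hGm r).aestronglyMeasurable) (measurable_bmPath hBm).aemeasurable]
      exact setIntegral_congr_fun (measurable_bmPath hBm hA₀m) fun ω _ ↦ hMG r ω
    have h2 : ∫ ω in slePath κ ⁻¹' A₀, Mc r ω ∂preWienerMeasure =
        ∫ p in A₀, G r p ∂(preWienerMeasure.map (slePath κ)) := by
      rw [setIntegral_map hA₀m ((hGm r).aestronglyMeasurable) (measurable_slePath κ).aemeasurable]
      exact setIntegral_congr_fun (measurable_slePath κ hA₀m) fun ω _ ↦ hMcG r ω
    rw [h1, h2, hlaw]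
  rw [key s, key t]
  exact hcan.setIntegral_eq hst (measurableSet_preimage_slePath hA₀)

end Transfer

end RadialLoewner

end Literature.Probability.RandomPlanarGeometry
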